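/- Free-seat work of EXTRA WIDTH SEAT `ym-line-cbag-p1-w4` (prover-ym-line-cbag-p1-w4-g2-0), route `EguchiKawaiDirectionLadder`
(ideator ym-idea-2, LINE 8), crux `TripleSmallBallMargin` (stmt-QuantumFields-27724): S9 of the LEAD's v7 architecture, the
«h1-provider»: from a small diagonal block of the commutator of the block-multiplied links to the BLOCK-LOCAL robust pair event
(hypothesis `h1` of `haar_prod_le_prod_mul_of_blockPair_fibres`).  ROUTE-INDEPENDENT.  Nothing here bears on the Yang–Mills mass gap. -/
import Summits.QuantumFields.YangMills.Theorems.EguchiKawaiDirectionLadderBlockPairAlgebra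
import Summits.QuantumFields.YangMills.Theorems.EguchiKawaiDirectionLadderRobustPairTransfer
import HarnessLib

/-!
# Route `EguchiKawaiDirectionLadder`: cross terms, their near/far split, and the block-local robust pair event (S9, h1-provider)

For links `X, Y` (in the eigenbasis of `U 0`), a labelling `ℓ`, block unitaries `D, D′`, a block `c` and a set `near` of labels
(the collar; every other label `≠ c` is «far»), `…BlockPairAlgebra` gives
`([X·ι(D), Y·ι(D′)])_{cc} = withinPair + Σ_{a≠c} crossTerm a`.  Here:

* `crossTerm ℓ X Y D D′ c a := X_{ca}D_a · Y_{ac}D′_c − Y_{ca}D′_a · X_{ac}D_c` and `withinPair ℓ X Y D D′ c := X_{cc}D_c·Y_{cc}D′_c − Y_{cc}D′_c·X_{cc}D_c`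
  (named, so that the bookkeeping below stays readable), with `rank (crossTerm a) ≤ 2#{ℓ=a}` and
  `Σ|crossTerm a|² ≤ 2(Σ|X_{ca}|²Σ|Y_{ac}|² + Σ|Y_{ca}|²Σ|X_{ac}|²)` UNIFORMLY in `D, D′`;
* `sum_norm_sq_finset_sum_le` — `Σ|(Σ_{a∈s} A_a)_{ij}|² ≤ #s · Σ_{a∈s} Σ|(A_a)_{ij}|²`;
* `crossTerms_split` — `Σ_{a≠c} crossTerm a = J + S`, `rank J ≤ 2Σ_{a∈near}#{ℓ=a}`, `Σ|S|² ≤ 2·#far·Σ_{far} farPairMass a`;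
* `blockLocal_robustPair_of_commutatorBlock_small` — if `Σ|([X·ι(D), Y·ι(D′)])_{cc}|² ≤ s` then
  `∃ J′, rank J′ ≤ 2Σ_{near}#{ℓ=a} ∧ Σ|withinPair − J′|² ≤ 2s + 2·(far bound)`: the pair `(D_c, D′_c)` lies in the block-local robust
  pair event `F_c X Y` to feed into `haar_prod_le_prod_mul_of_blockPair_fibres` (`…BlockPairLaw`); its Haar-pair measure is then
  bounded by `haar_prod_robustPairEvent_transfer` + `compression_eq_unitary_add_lowRank_add_small'` + (Ψ_rob).

HONEST FRAMING: linear algebra only.  The route bears on the barrier-ledger fact `EguchiKawaiBreakdown` only.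
-/

set_option autoImplicit false

noncomputable section

open scoped Matrix
open Literature.Barriers.QuantumFields

namespace Summit.QuantumFields.YangMills.Theorems.EguchiKawaiDirectionLadder

/-! ### §1 Frobenius mass of a finite sum of matrices -/

section FinsetSum

variable {α : Type} [Fintype α] {ι : Type*}

/-- `Σ|(Σ_{a∈s} A_a)_{ij}|² ≤ #s · Σ_{a∈s} Σ|(A_a)_{ij}|²` (triangle inequality + Cauchy–Schwarz on the index set). -/
theorem sum_norm_sq_finset_sum_le (s : Finset ι) (A : ι → Matrix α α ℂ) :
    ∑ i, ∑ j, ‖(∑ a ∈ s, A a) i j‖ ^ 2 ≤ s.card * ∑ a ∈ s, ∑ i, ∑ j, ‖A a i j‖ ^ 2 := by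
  have hentry : ∀ i j, ‖(∑ a ∈ s, A a) i j‖ ^ 2 ≤ s.card * ∑ a ∈ s, ‖A a i j‖ ^ 2 := by
    intro i j
    rw [Matrix.sum_apply]
    have h1 : ‖∑ a ∈ s, A a i j‖ ≤ ∑ a ∈ s, ‖A a i j‖ := norm_sum_le _ _
    calc ‖∑ a ∈ s, A a i j‖ ^ 2 ≤ (∑ a ∈ s, ‖A a i j‖) ^ 2 := pow_le_pow_left₀ (norm_nonneg _) h1 2
      _ ≤ s.card * ∑ a ∈ s, ‖A a i j‖ ^ 2 := sq_sum_le_card_mul_sum_sq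
  calc ∑ i, ∑ j, ‖(∑ a ∈ s, A a) i j‖ ^ 2 ≤ ∑ i, ∑ j, (s.card : ℝ) * ∑ a ∈ s, ‖A a i j‖ ^ 2 :=
        Finset.sum_le_sum fun i _ => Finset.sum_le_sum fun j _ => hentry i j
    _ = s.card * ∑ a ∈ s, ∑ i, ∑ j, ‖A a i j‖ ^ 2 := by
        rw [Finset.sum_comm (s := s)]
        simp only [← Finset.mul_sum]
        congr 1
        refine Finset.sum_congr rfl fun i _ => ?_
        rw [Finset.sum_comm]

end FinsetSum

/-! ### §2 Cross terms and the within-block pair -/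

section Cross

variable {N m : ℕ}

/-- The cross term of label `a` in the block `c` of `[X·ι(D), Y·ι(D′)]`: `X_{ca}D_a · Y_{ac}D′_c − Y_{ca}D′_a · X_{ac}D_c`. -/
def crossTerm (ℓ : Fin N → Fin m) (X Y : Matrix (Fin N) (Fin N) ℂ) (V V' : BlockUnitaries ℓ) (c a : Fin m) :
    Matrix {i : Fin N // ℓ i = c} {i : Fin N // ℓ i = c} ℂ :=
  X.toBlock (fun i => ℓ i = c) (fun i => ℓ i = a) * (V a : Matrix {i : Fin N // ℓ i = a} {i : Fin N // ℓ i = a} ℂ) *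
      (Y.toBlock (fun i => ℓ i = a) (fun i => ℓ i = c) * (V' c : Matrix {i : Fin N // ℓ i = c} {i : Fin N // ℓ i = c} ℂ)) -
    Y.toBlock (fun i => ℓ i = c) (fun i => ℓ i = a) * (V' a : Matrix {i : Fin N // ℓ i = a} {i : Fin N // ℓ i = a} ℂ) *
      (X.toBlock (fun i => ℓ i = a) (fun i => ℓ i = c) * (V c : Matrix {i : Fin N // ℓ i = c} {i : Fin N // ℓ i = c} ℂ))

/-- The within-block pair of block `c`: `X_{cc}D_c · Y_{cc}D′_c − Y_{cc}D′_c · X_{cc}D_c`. -/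
def withinPair (ℓ : Fin N → Fin m) (X Y : Matrix (Fin N) (Fin N) ℂ) (V V' : BlockUnitaries ℓ) (c : Fin m) :
    Matrix {i : Fin N // ℓ i = c} {i : Fin N // ℓ i = c} ℂ :=
  crossTerm ℓ X Y V V' c c

/-- The far pair mass of label `a` seen from block `c`: `Σ|X_{ca}|²Σ|Y_{ac}|² + Σ|Y_{ca}|²Σ|X_{ac}|²`. -/
def farPairMass (ℓ : Fin N → Fin m) (X Y : Matrix (Fin N) (Fin N) ℂ) (c a : Fin m) : ℝ :=
  (∑ i, ∑ j, ‖X.toBlock (fun i => ℓ i = c) (fun i => ℓ i = a) i j‖ ^ 2) *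
      (∑ i, ∑ j, ‖Y.toBlock (fun i => ℓ i = a) (fun i => ℓ i = c) i j‖ ^ 2) +
    (∑ i, ∑ j, ‖Y.toBlock (fun i => ℓ i = c) (fun i => ℓ i = a) i j‖ ^ 2) *
      (∑ i, ∑ j, ‖X.toBlock (fun i => ℓ i = a) (fun i => ℓ i = c) i j‖ ^ 2)

/-- The diagonal block `c` of the commutator = within pair + Σ_{a ≠ c} cross terms. -/
theorem toBlock_commutator_mul_blockDiag_eq_withinPair_add_sum_crossTerm (ℓ : Fin N → Fin m) (X Y : Matrix (Fin N) (Fin N) ℂ)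
    (V V' : BlockUnitaries ℓ) (c : Fin m) :
    (X * blockDiag ℓ (fun a => (V a : Matrix {i : Fin N // ℓ i = a} {i : Fin N // ℓ i = a} ℂ)) *
          (Y * blockDiag ℓ (fun a => (V' a : Matrix {i : Fin N // ℓ i = a} {i : Fin N // ℓ i = a} ℂ))) -
        Y * blockDiag ℓ (fun a => (V' a : Matrix {i : Fin N // ℓ i = a} {i : Fin N // ℓ i = a} ℂ)) *
          (X * blockDiag ℓ (fun a => (V a : Matrix {i : Fin N // ℓ i = a} {i : Fin N // ℓ i = a} ℂ)))).toBlock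
        (fun i => ℓ i = c) (fun i => ℓ i = c) =
      withinPair ℓ X Y V V' c + ∑ a ∈ Finset.univ.erase c, crossTerm ℓ X Y V V' c a :=
  toBlock_commutator_mul_blockDiag_eq_diag_add_cross ℓ X Y _ _ c

/-- Rank of a cross term: `≤ 2#{ℓ = a}` (uniform in everything else). -/
theorem rank_crossTerm_le (ℓ : Fin N → Fin m) (X Y : Matrix (Fin N) (Fin N) ℂ) (V V' : BlockUnitaries ℓ) (c a : Fin m) :
    (crossTerm ℓ X Y V V' c a).rank ≤ 2 * Fintype.card {i : Fin N // ℓ i = a} := by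
  unfold crossTerm
  refine (rank_sub_le _ _).trans ?_
  have h1 := rank_crossTerm_le_card ℓ X Y (fun a => (V a : Matrix {i : Fin N // ℓ i = a} {i : Fin N // ℓ i = a} ℂ))
    (fun a => (V' a : Matrix {i : Fin N // ℓ i = a} {i : Fin N // ℓ i = a} ℂ)) c a
  have h2 := rank_crossTerm_le_card ℓ Y X (fun a => (V' a : Matrix {i : Fin N // ℓ i = a} {i : Fin N // ℓ i = a} ℂ))
    (fun a => (V a : Matrix {i : Fin N // ℓ i = a} {i : Fin N // ℓ i = a} ℂ)) c a
  omega

/-- Frobenius mass of a cross term: `≤ 2·farPairMass` (uniform in the block unitaries). -/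
theorem sum_norm_sq_crossTerm_le_farPairMass (ℓ : Fin N → Fin m) (X Y : Matrix (Fin N) (Fin N) ℂ) (V V' : BlockUnitaries ℓ)
    (c a : Fin m) : ∑ i, ∑ j, ‖crossTerm ℓ X Y V V' c a i j‖ ^ 2 ≤ 2 * farPairMass ℓ X Y c a := by
  unfold crossTerm farPairMass
  have h := sum_norm_sq_sub_le
    (X.toBlock (fun i => ℓ i = c) (fun i => ℓ i = a) * (V a : Matrix {i : Fin N // ℓ i = a} {i : Fin N // ℓ i = a} ℂ) *
      (Y.toBlock (fun i => ℓ i = a) (fun i => ℓ i = c) * (V' c : Matrix {i : Fin N // ℓ i = c} {i : Fin N // ℓ i = c} ℂ)))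
    (Y.toBlock (fun i => ℓ i = c) (fun i => ℓ i = a) * (V' a : Matrix {i : Fin N // ℓ i = a} {i : Fin N // ℓ i = a} ℂ) *
      (X.toBlock (fun i => ℓ i = a) (fun i => ℓ i = c) * (V c : Matrix {i : Fin N // ℓ i = c} {i : Fin N // ℓ i = c} ℂ)))
  have h1 := sum_norm_sq_crossTerm_le ℓ X Y V V' c a
  have h2 := sum_norm_sq_crossTerm_le ℓ Y X V' V c a
  linarith

/-! ### §3 The near/far split and the block-local robust pair event -/

/-- **Near/far split of the cross terms**: `Σ_{a≠c} crossTerm a = J + S` with `rank J ≤ 2Σ_{a∈near}#{ℓ=a}` and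
`Σ|S|² ≤ 2·#far·Σ_{a far} farPairMass a`, `far = {a ≠ c, a ∉ near}`. -/
theorem crossTerms_split (ℓ : Fin N → Fin m) (X Y : Matrix (Fin N) (Fin N) ℂ) (V V' : BlockUnitaries ℓ) (c : Fin m)
    (near : Finset (Fin m)) :
    ∃ J S : Matrix {i : Fin N // ℓ i = c} {i : Fin N // ℓ i = c} ℂ,
      ∑ a ∈ Finset.univ.erase c, crossTerm ℓ X Y V V' c a = J + S ∧
      J.rank ≤ 2 * ∑ a ∈ near, Fintype.card {i : Fin N // ℓ i = a} ∧
      ∑ i, ∑ j, ‖S i j‖ ^ 2 ≤ 2 * ((Finset.univ.erase c).filter (fun a => a ∉ near)).card *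
        ∑ a ∈ (Finset.univ.erase c).filter (fun a => a ∉ near), farPairMass ℓ X Y c a := by
  classical
  set O : Finset (Fin m) := Finset.univ.erase c with hO
  refine ⟨∑ a ∈ O.filter (fun a => a ∈ near), crossTerm ℓ X Y V V' c a,
    ∑ a ∈ O.filter (fun a => a ∉ near), crossTerm ℓ X Y V V' c a, ?_, ?_, ?_⟩
  · exact (Finset.sum_filter_add_sum_filter_not O (fun a => a ∈ near) _).symm
  · calc (∑ a ∈ O.filter (fun a => a ∈ near), crossTerm ℓ X Y V V' c a).rank
        ≤ ∑ a ∈ O.filter (fun a => a ∈ near), (crossTerm ℓ X Y V V' c a).rank := rank_sum_le _ _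
      _ ≤ ∑ a ∈ O.filter (fun a => a ∈ near), 2 * Fintype.card {i : Fin N // ℓ i = a} :=
          Finset.sum_le_sum fun a _ => rank_crossTerm_le ℓ X Y V V' c a
      _ ≤ ∑ a ∈ near, 2 * Fintype.card {i : Fin N // ℓ i = a} :=
          Finset.sum_le_sum_of_subset fun a ha => (Finset.mem_filter.1 ha).2
      _ = 2 * ∑ a ∈ near, Fintype.card {i : Fin N // ℓ i = a} := by rw [Finset.mul_sum]
  · calc ∑ i, ∑ j, ‖(∑ a ∈ O.filter (fun a => a ∉ near), crossTerm ℓ X Y V V' c a) i j‖ ^ 2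
        ≤ (O.filter (fun a => a ∉ near)).card *
            ∑ a ∈ O.filter (fun a => a ∉ near), ∑ i, ∑ j, ‖crossTerm ℓ X Y V V' c a i j‖ ^ 2 :=
          sum_norm_sq_finset_sum_le _ _
      _ ≤ (O.filter (fun a => a ∉ near)).card *
            ∑ a ∈ O.filter (fun a => a ∉ near), 2 * farPairMass ℓ X Y c a := by
          gcongr with a _
          exact sum_norm_sq_crossTerm_le_farPairMass ℓ X Y V V' c a
      _ = 2 * (O.filter (fun a => a ∉ near)).card * ∑ a ∈ O.filter (fun a => a ∉ near), farPairMass ℓ X Y c a := by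
          rw [← Finset.mul_sum]; ring

/-- **The block-local robust pair event follows from a small commutator block** (the `h1` of the decoupling inequality): if
`Σ|([X·ι(D), Y·ι(D′)])_{cc}|² ≤ s` then `∃ J′`, `rank J′ ≤ 2Σ_{a∈near}#{ℓ=a}`, `Σ|withinPair − J′|² ≤ 2s + 2·(far bound)`. -/
theorem blockLocal_robustPair_of_commutatorBlock_small (ℓ : Fin N → Fin m) (X Y : Matrix (Fin N) (Fin N) ℂ)
    (V V' : BlockUnitaries ℓ) (c : Fin m) (near : Finset (Fin m)) {s : ℝ}
    (hs : ∑ i, ∑ j, ‖(X * blockDiag ℓ (fun a => (V a : Matrix {i : Fin N // ℓ i = a} {i : Fin N // ℓ i = a} ℂ)) *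
          (Y * blockDiag ℓ (fun a => (V' a : Matrix {i : Fin N // ℓ i = a} {i : Fin N // ℓ i = a} ℂ))) -
        Y * blockDiag ℓ (fun a => (V' a : Matrix {i : Fin N // ℓ i = a} {i : Fin N // ℓ i = a} ℂ)) *
          (X * blockDiag ℓ (fun a => (V a : Matrix {i : Fin N // ℓ i = a} {i : Fin N // ℓ i = a} ℂ)))).toBlock
          (fun i => ℓ i = c) (fun i => ℓ i = c) i j‖ ^ 2 ≤ s) :
    ∃ J' : Matrix {i : Fin N // ℓ i = c} {i : Fin N // ℓ i = c} ℂ,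
      J'.rank ≤ 2 * ∑ a ∈ near, Fintype.card {i : Fin N // ℓ i = a} ∧
      ∑ i, ∑ j, ‖(withinPair ℓ X Y V V' c - J') i j‖ ^ 2 ≤
        2 * s + 2 * (2 * ((Finset.univ.erase c).filter (fun a => a ∉ near)).card *
          ∑ a ∈ (Finset.univ.erase c).filter (fun a => a ∉ near), farPairMass ℓ X Y c a) := by
  obtain ⟨J, S, hsum, hJ, hS⟩ := crossTerms_split ℓ X Y V V' c near
  have hdec := toBlock_commutator_mul_blockDiag_eq_withinPair_add_sum_crossTerm ℓ X Y V V' c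
  rw [hsum] at hdec
  refine ⟨-J, by rw [rank_neg]; exact hJ, ?_⟩
  set B := (X * blockDiag ℓ (fun a => (V a : Matrix {i : Fin N // ℓ i = a} {i : Fin N // ℓ i = a} ℂ)) *
          (Y * blockDiag ℓ (fun a => (V' a : Matrix {i : Fin N // ℓ i = a} {i : Fin N // ℓ i = a} ℂ))) -
        Y * blockDiag ℓ (fun a => (V' a : Matrix {i : Fin N // ℓ i = a} {i : Fin N // ℓ i = a} ℂ)) *
          (X * blockDiag ℓ (fun a => (V a : Matrix {i : Fin N // ℓ i = a} {i : Fin N // ℓ i = a} ℂ)))).toBlock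
          (fun i => ℓ i = c) (fun i => ℓ i = c) with hB
  have hrew : withinPair ℓ X Y V V' c - -J = B - S := by rw [hdec]; abel
  rw [hrew]
  have h := sum_norm_sq_sub_le B S
  linarith

end Cross

end Summit.QuantumFields.YangMills.Theorems.EguchiKawaiDirectionLadder

end
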